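import Summits.Ventures.HodgeRepro2.T5SU11JacobiIwasawa
import Summits.Ventures.HodgeRepro2.T5SU11SphericalProduct

/-!
# The spherical transform of the lowest-weight coefficient modulus `(1 − |g·0|²)^{k/2}` in closed form

For `m_k(g) = (1 − |g·0|²)^{k/2}` (the modulus of the weight-`k` lowest-weight coefficient of the
discrete series of `SU(1,1)`, `T5SU11CoeffPowCartan`) and the spherical function
`φ_λ(g) = ∫_K e^{λ t(k g)} dk` (`T5SU11SphericalFunction`), the `K`-average is removed by Fubini on
`G × K` (`integrable_prod_iff` with the `G`-sections `g ↦ m_k(g) e^{λ t(k g)} = F_{k,λ}(k g)`, integrable by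
left translation, and a CONSTANT outer integral) and the left invariance of `ν` and of `m_k`:
**`∫_G m_k φ_λ dν = ∫_G m_k e^{λ t} dν`** (`integral_orbit_rpow_mul_sph_eq`), hence by the
Iwasawa-coordinate evaluation of `T5SU11JacobiIwasawa`
**`∫_G (1 − |g·0|²)^{k/2} φ_λ(g) dν = 2^{k−2} √π Γ((k−1)/2)/Γ(k/2) · Γ((k−λ)/2) Γ((k+λ)/2 − 1)/Γ(k−1)`**
for `k > 1`, `λ < k`, `k + λ > 2` (`integral_orbit_rpow_mul_sph`) — the Jacobi-function transform of
`cosh^{-k}` in the Cartan parameter, with its integrability (`integrable_orbit_rpow_mul_sph`). The value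
is invariant under `λ ↦ 2 − λ` as the functional equation `φ_λ = φ_{2−λ}` demands
(`integral_orbit_rpow_mul_sph_two_sub`), and at `λ = 0` (`φ_0 ≡ 1`) it is `2π/(k − 2)`
(`integral_orbit_rpow_mul_sph_zero`). Nothing is claimed about (N).

Blind lane: Mathlib + the HodgeRepro2 prefix only; no sorry; axioms ⊆ {propext, Classical.choice,
Quot.sound}.
-/

namespace Summit.Ventures.HodgeRepro2.T5SU11JacobiTransform

open MeasureTheory MeasureTheory.Measure Metric Set Filter Topology Complex
open T5SU11Unimodular T5SU11Fibration T5SU11Cartan T5SU11OneParameter T5SU11CartanProjection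
  T5HaarCircle T5BergmanCoefficient T5SU11FibrationHaar T5SU11IwasawaProjection
  T5SU11CoeffSqCartan T5SU11SphericalFunction T5SU11SphericalSymmetry T5SU11SphericalContinuous
  T5SU11SphericalProduct T5SU11JacobiIwasawa
open scoped Real

/-! ### The integrand on `G × K` -/

/-- `m_k(rot u · g) = m_k(g)`: left-`K`-invariance of the coefficient modulus. -/
lemma orbit_rpow_rot_mul (k : ℝ) (u : Circle) (g : SU11) :
    (1 - ‖orbit (rot u * g)‖ ^ 2) ^ (k / 2) = (1 - ‖orbit g‖ ^ 2) ^ (k / 2) := by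
  rw [norm_orbit_rot_mul]

/-- The `G`-section of the integrand is the left translate of `F_{k,λ}` by `rot u`:
`m_k(g) e^{λ t(rot u · g)} = F_{k,λ}(rot u · g)`. -/
lemma orbit_rpow_mul_exp_eq_translate (k lam : ℝ) (u : Circle) (g : SU11) :
    (1 - ‖orbit g‖ ^ 2) ^ (k / 2) * Real.exp (lam * iwasawaT (rot u * g))
      = (1 - ‖orbit (rot u * g)‖ ^ 2) ^ (k / 2) * Real.exp (lam * iwasawaT (rot u * g)) := by
  rw [orbit_rpow_rot_mul]

/-- `0 < 1 − |g·0|²`. -/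
lemma one_sub_norm_orbit_sq_pos (g : SU11) : 0 < 1 - ‖orbit g‖ ^ 2 := by
  have := orbit_mem_ball g
  rw [mem_ball_zero_iff] at this
  have h2 : ‖orbit g‖ ^ 2 < 1 := by nlinarith [norm_nonneg (orbit g)]
  linarith

/-- `0 ≤ m_k(g)`. -/
lemma orbit_rpow_nonneg (k : ℝ) (g : SU11) : 0 ≤ (1 - ‖orbit g‖ ^ 2) ^ (k / 2) :=
  Real.rpow_nonneg (one_sub_norm_orbit_sq_pos g).le _

/-- `m_k` is continuous. -/
lemma continuous_orbit_rpow (k : ℝ) : Continuous fun g : SU11 => (1 - ‖orbit g‖ ^ 2) ^ (k / 2) := by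
  have h : Continuous fun g : SU11 => 1 - ‖orbit g‖ ^ 2 :=
    continuous_const.sub (continuous_orbit.norm.pow 2)
  exact h.rpow_const fun g => Or.inl (one_sub_norm_orbit_sq_pos g).ne'

/-- The integrand `(g, u) ↦ m_k(g) e^{λ t(rot u · g)}` is continuous on `G × K`. -/
lemma continuous_sphIntegrand (k lam : ℝ) :
    Continuous fun p : SU11 × Circle =>
      (1 - ‖orbit p.1‖ ^ 2) ^ (k / 2) * Real.exp (lam * iwasawaT (rot p.2 * p.1)) :=
  ((continuous_orbit_rpow k).comp continuous_fst).mul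
    (Real.continuous_exp.comp (continuous_const.mul
      (continuous_iwasawaT.comp ((continuous_rot.comp continuous_snd).mul continuous_fst))))

/-! ### The transform -/

section measure

variable [MeasurableSpace Circle] [BorelSpace Circle]

/-- The integrand is integrable on `G × K` (Fubini's criterion with the `K`-variable outside: the
`G`-sections are left translates of `F_{k,λ}`, and the outer function is constant). -/
theorem integrable_sphIntegrand {k lam : ℝ} (hk : 1 < k) (h1 : lam < k) (h2 : 2 < k + lam) :
    Integrable (fun p : SU11 × Circle =>
      (1 - ‖orbit p.1‖ ^ 2) ^ (k / 2) * Real.exp (lam * iwasawaT (rot p.2 * p.1)))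
      ((nu haarCircle).prod haarCircle) := by
  have hF := integrable_orbit_rpow_mul_exp_iwasawaT hk h1 h2
  refine (integrable_prod_iff' (continuous_sphIntegrand k lam).aestronglyMeasurable).mpr
    ⟨Filter.Eventually.of_forall fun u => ?_, ?_⟩
  · show Integrable (fun g : SU11 =>
      (1 - ‖orbit g‖ ^ 2) ^ (k / 2) * Real.exp (lam * iwasawaT (rot u * g))) (nu haarCircle)
    have e : (fun g : SU11 => (1 - ‖orbit g‖ ^ 2) ^ (k / 2) * Real.exp (lam * iwasawaT (rot u * g)))
        = fun g => (fun h : SU11 => (1 - ‖orbit h‖ ^ 2) ^ (k / 2) * Real.exp (lam * iwasawaT h))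
          (rot u * g) := by
      funext g
      exact orbit_rpow_mul_exp_eq_translate k lam u g
    rw [e]
    exact hF.comp_mul_left (rot u)
  · show Integrable (fun u : Circle => ∫ g, ‖(1 - ‖orbit g‖ ^ 2) ^ (k / 2)
      * Real.exp (lam * iwasawaT (rot u * g))‖ ∂(nu haarCircle)) haarCircle
    have e : (fun u : Circle => ∫ g, ‖(1 - ‖orbit g‖ ^ 2) ^ (k / 2)
        * Real.exp (lam * iwasawaT (rot u * g))‖ ∂(nu haarCircle))
        = fun _ => ∫ g, (1 - ‖orbit g‖ ^ 2) ^ (k / 2) * Real.exp (lam * iwasawaT g) ∂(nu haarCircle) := by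
      funext u
      rw [← integral_mul_left_eq_self
        (fun g : SU11 => (1 - ‖orbit g‖ ^ 2) ^ (k / 2) * Real.exp (lam * iwasawaT g)) (rot u)]
      refine integral_congr_ae (Filter.Eventually.of_forall fun g => ?_)
      beta_reduce
      rw [Real.norm_eq_abs, abs_of_nonneg (mul_nonneg (orbit_rpow_nonneg k g) (Real.exp_pos _).le)]
      exact orbit_rpow_mul_exp_eq_translate k lam u g
    rw [e]
    exact integrable_const _

/-- **The `K`-average is removed**: `∫_G m_k φ_λ dν = ∫_G m_k e^{λ t} dν` for `k > 1`, `λ < k`,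
`k + λ > 2` (Fubini on `G × K`, the left invariance of `ν` and of `m_k`). -/
theorem integral_orbit_rpow_mul_sph_eq {k lam : ℝ} (hk : 1 < k) (h1 : lam < k) (h2 : 2 < k + lam) :
    ∫ g, (1 - ‖orbit g‖ ^ 2) ^ (k / 2) * sph lam g ∂(nu haarCircle)
      = ∫ g, (1 - ‖orbit g‖ ^ 2) ^ (k / 2) * Real.exp (lam * iwasawaT g) ∂(nu haarCircle) := by
  have hf := integrable_sphIntegrand hk h1 h2
  have e1 : ∫ g, (1 - ‖orbit g‖ ^ 2) ^ (k / 2) * sph lam g ∂(nu haarCircle)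
      = ∫ g, ∫ u, (1 - ‖orbit g‖ ^ 2) ^ (k / 2) * Real.exp (lam * iwasawaT (rot u * g))
          ∂haarCircle ∂(nu haarCircle) := by
    congr 1
    funext g
    rw [sph, integral_const_mul]
  rw [e1, ← integral_prod _ hf, integral_prod_symm _ hf]
  have e2 : ∀ u : Circle,
      ∫ g, (1 - ‖orbit g‖ ^ 2) ^ (k / 2) * Real.exp (lam * iwasawaT (rot u * g)) ∂(nu haarCircle)
      = ∫ g, (1 - ‖orbit g‖ ^ 2) ^ (k / 2) * Real.exp (lam * iwasawaT g) ∂(nu haarCircle) := by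
    intro u
    rw [← integral_mul_left_eq_self
      (fun g : SU11 => (1 - ‖orbit g‖ ^ 2) ^ (k / 2) * Real.exp (lam * iwasawaT g)) (rot u)]
    refine integral_congr_ae (Filter.Eventually.of_forall fun g => ?_)
    beta_reduce
    exact orbit_rpow_mul_exp_eq_translate k lam u g
  simp_rw [e2]
  rw [integral_const, measureReal_def, haarCircle_univ, ENNReal.toReal_one, one_smul]

/-- **THE SPHERICAL TRANSFORM OF THE LOWEST-WEIGHT COEFFICIENT MODULUS IN CLOSED FORM**: for `k > 1`,
`λ < k`, `k + λ > 2`,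
`∫_G (1 − |g·0|²)^{k/2} φ_λ(g) dν = 2^{k−2} √π Γ((k−1)/2)/Γ(k/2) · Γ((k−λ)/2) Γ((k+λ)/2 − 1)/Γ(k−1)`. -/
theorem integral_orbit_rpow_mul_sph {k lam : ℝ} (hk : 1 < k) (h1 : lam < k) (h2 : 2 < k + lam) :
    ∫ g, (1 - ‖orbit g‖ ^ 2) ^ (k / 2) * sph lam g ∂(nu haarCircle)
      = 2 ^ (k - 2) * (√π * Real.Gamma ((k - 1) / 2) / Real.Gamma (k / 2))
          * (Real.Gamma ((k - lam) / 2) * Real.Gamma ((k + lam) / 2 - 1) / Real.Gamma (k - 1)) := by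
  rw [integral_orbit_rpow_mul_sph_eq hk h1 h2, integral_orbit_rpow_mul_exp_iwasawaT hk h1 h2]

/-- `m_k · φ_λ` is `ν`-integrable for `k > 1`, `λ < k`, `k + λ > 2` (a posteriori). -/
theorem integrable_orbit_rpow_mul_sph {k lam : ℝ} (hk : 1 < k) (h1 : lam < k) (h2 : 2 < k + lam) :
    Integrable (fun g => (1 - ‖orbit g‖ ^ 2) ^ (k / 2) * sph lam g) (nu haarCircle) := by
  by_contra h
  have h0 := integral_undef h
  rw [integral_orbit_rpow_mul_sph hk h1 h2] at h0
  have g1 : 0 < Real.Gamma ((k - 1) / 2) := Real.Gamma_pos_of_pos (by linarith)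
  have g2 : 0 < Real.Gamma (k / 2) := Real.Gamma_pos_of_pos (by linarith)
  have g3 : 0 < Real.Gamma ((k - lam) / 2) := Real.Gamma_pos_of_pos (by linarith)
  have g4 : 0 < Real.Gamma ((k + lam) / 2 - 1) := Real.Gamma_pos_of_pos (by linarith)
  have g5 : 0 < Real.Gamma (k - 1) := Real.Gamma_pos_of_pos (by linarith)
  have g6 : (0 : ℝ) < 2 ^ (k - 2) := Real.rpow_pos_of_pos (by norm_num) _
  have : 0 < 2 ^ (k - 2) * (√π * Real.Gamma ((k - 1) / 2) / Real.Gamma (k / 2))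
      * (Real.Gamma ((k - lam) / 2) * Real.Gamma ((k + lam) / 2 - 1) / Real.Gamma (k - 1)) := by
    positivity
  linarith

/-- **`W`-symmetry of the closed form**: the value at `2 − λ` equals the value at `λ` — as the
functional equation `φ_λ = φ_{2−λ}` (`sph_two_sub`) demands, but read off from the Gamma quotient
alone (the two Gamma factors are exchanged). -/
theorem integral_orbit_rpow_mul_sph_two_sub {k lam : ℝ} (hk : 1 < k) (h1 : lam < k)
    (h2 : 2 < k + lam) :
    ∫ g, (1 - ‖orbit g‖ ^ 2) ^ (k / 2) * sph (2 - lam) g ∂(nu haarCircle)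
      = ∫ g, (1 - ‖orbit g‖ ^ 2) ^ (k / 2) * sph lam g ∂(nu haarCircle) := by
  rw [integral_orbit_rpow_mul_sph hk (by linarith) (by linarith), integral_orbit_rpow_mul_sph hk h1 h2,
    show (k - (2 - lam)) / 2 = (k + lam) / 2 - 1 by ring,
    show (k + (2 - lam)) / 2 - 1 = (k - lam) / 2 by ring, mul_comm (Real.Gamma ((k + lam) / 2 - 1))]

/-- The same symmetry from the functional equation `φ_{2−λ} = φ_λ` pointwise (`sph_two_sub`). -/
theorem integral_orbit_rpow_mul_sph_two_sub' (k lam : ℝ) :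
    ∫ g, (1 - ‖orbit g‖ ^ 2) ^ (k / 2) * sph (2 - lam) g ∂(nu haarCircle)
      = ∫ g, (1 - ‖orbit g‖ ^ 2) ^ (k / 2) * sph lam g ∂(nu haarCircle) := by
  simp_rw [← sph_two_sub lam]

/-- **`λ = 0`** (`φ_0 ≡ 1`): `∫_G (1 − |g·0|²)^{k/2} φ_0 dν = 2π/(k − 2)` for `k > 2`. -/
theorem integral_orbit_rpow_mul_sph_zero {k : ℝ} (hk : 2 < k) :
    ∫ g, (1 - ‖orbit g‖ ^ 2) ^ (k / 2) * sph 0 g ∂(nu haarCircle) = 2 * π / (k - 2) := by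
  simp_rw [sph_zero, mul_one]
  exact integral_orbit_rpow_nu hk

/-- **`λ = 1`** (Harish-Chandra's `Ξ = φ_1`): `∫_G (1 − |g·0|²)^{k/2} Ξ(g) dν = 2^{k−2} √π Γ((k−1)/2)²/(Γ(k/2) Γ(k−1))`
for `k > 1`. -/
theorem integral_orbit_rpow_mul_sph_one {k : ℝ} (hk : 1 < k) :
    ∫ g, (1 - ‖orbit g‖ ^ 2) ^ (k / 2) * sph 1 g ∂(nu haarCircle)
      = 2 ^ (k - 2) * (√π * Real.Gamma ((k - 1) / 2) / Real.Gamma (k / 2))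
          * (Real.Gamma ((k - 1) / 2) ^ 2 / Real.Gamma (k - 1)) := by
  rw [integral_orbit_rpow_mul_sph hk (by linarith) (by linarith),
    show (k + 1) / 2 - 1 = (k - 1) / 2 by ring, sq]

end measure

end Summit.Ventures.HodgeRepro2.T5SU11JacobiTransform
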